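import Summits.Ventures.CertifiedManyBodySolver.Downfold.TppSeam
import Summits.Ventures.CertifiedManyBodySolver.Downfold.S2Seam
import Literature.MathematicalPhysics.QuantumLattice.HubbardTTPrimeTPPFillingTransport
import Literature.MathematicalPhysics.QuantumLattice.HubbardHoppingBondNormSharp
import Literature.MathematicalPhysics.QuantumLattice.InfVolFermionStateLatticeMapPullback
import HarnessLib

/-!
# The `t''` seam AT FIXED FILLING: S2's certified `t–t'` words (object E, filling `n`) become words
# about the fixed-filling energy density of the `t–t'–t''` object (M) of a material box

Venture CertifiedManyBodySolver, cell `pub/hubbard-downfold` (stage S1), seat hubbard-downfold-mod-1;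
namespace `Summit.Ventures.CertifiedManyBodySolver.Downfold`. Companion of `TppSeam.lean` /
`TppSeamSharp.lean` (the same transfer for the UNCONSTRAINED translation-invariant density
`tiGroundEnergyDensity`, constants `8` and `4`) and of
`Literature/…/HubbardTTPrimeTPPFillingTransport.lean` (the `t–t'–t''` model at filling `ρ`:
`e_ρ(t,t',t'',U) := (hubbardTT'T''FermionInteraction t t' t'' U).tiGroundEnergyDensityAt 2 ρ`, at
`t'' = 0` equal to the certified `energyDensityTT' t t' U ρ`; pencil transport over a state class).

WHY THIS FILE: every certified energy word of record at stage S2 (hubbard-fast: the cell words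
`cw_…_word_Icc`, the box words `box…_word_Icc`) is a statement
`∀ θ ∈ Set.Icc lo hi, L ≤ energyDensityTT' 1 (θ 1) (θ 0) (θ 2) ≤ R` about the `t–t'` energy density AT
FILLING `θ 2 = n` — the object the `μ = 0` seam of `TppSeam.lean` does not address. Here the same
(T1) rule is run at fixed filling:

* `holdsOn_inflate_of_lipschitzOn` — the (T1) rule with the Lipschitz hypothesis required on the box
  only (members `B.Mem p`), so that class bounds valid on the box's filling range suffice.
* `abs_tiGroundEnergyDensityAt_tpp_sub_le_of_classBound` — Lipschitz in `t''` at filling `ρ` from ANY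
  class-wide bound `|K₃(σ)| ≤ C` on the third-neighbour bond density of the translation-invariant states
  of density `ρ` (an unrealised `ρ` is the trivial case); `…_le_four_mul` — the instance `C = 4` from
  the sharp bond norm (`norm_meanEnergyObs_axialRange2Hopping_le_two_mul`), every `ρ`.
* `holdsOn_tiGroundEnergyDensityAt_objectM_of_classBound` — THE SEAM AT FIXED FILLING, generic in the
  class constant: a box `B` with entries `eU, eS, eSS, eN` (`U/t`, `tp/t`, `tpp/t`, `n`), `eU.lo ≥ 0`,
  `0 < eN.lo`, `eN.hi < 2`, an S2 statement `∀ θ ∈ Set.Icc (s2Lo eU eS eN) (s2Hi eU eS eN),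
  L ≤ energyDensityTT' 1 (θ 1) (θ 0) (θ 2) ≤ R` (EXACTLY the `_word_Icc` shape, `S2Seam.lean`) and a class
  bound `C` valid at every filling of the box give
  `L − C·m ≤ e_{p n}(1, p tp/t, p tpp/t, p U/t) ≤ R + C·m` on `B`, `m = max |eSS.lo| |eSS.hi|`.
* `holdsOn_tiGroundEnergyDensityAt_objectM_four` — the instance `C = 4`, usable today on every
  material box of record (La-214: `m = 0.14 ⇒ ±0.56 t`; the kinematic class constant `16/π²`, when it
  lands in the tree, plugs into the generic theorem and gives `±0.227 t`).
* `objectM_filling_window_of_kinematic` — the bookkeeping identity for the phase-map annex.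

Everything here is PROVED. HONEST FRAMING: energy words only; a downfolded box is a systematic
modelling claim (hypothesis `B.Mem p`); the identification of `e_ρ` with a torus thermodynamic limit is
proved in the tree at `t'' = 0` only (`tiGroundEnergyDensityAt_hubbardTT'T''_zero`); nothing here bears
on order or pairing words, and no number about any material is certified by this file.
-/

namespace Summit.Ventures.CertifiedManyBodySolver.Downfold

open NonemptyInterval Literature.MathematicalPhysics.QuantumLattice
  Literature.MathematicalPhysics.QuantumLattice.ThermodynamicLimit

/-! ### The (T1) rule with a members-only Lipschitz hypothesis -/

/-- **The (T1) rule, Lipschitz hypothesis on the box only.** Let `B` carry the entry `eSS` for `tpp/t`,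
let `|f p s'' − f p 0| ≤ C|s''|` hold for every MEMBER `p` of `B` (`C ≥ 0`), and let the window
`L ≤ f p 0 ≤ R` hold on `B`. Then `L − C·m ≤ f p (p tppOverT) ≤ R + C·m` holds on `B`,
`m = max |eSS.lo| |eSS.hi|`. [folklore] -/
theorem holdsOn_inflate_of_lipschitzOn {B : OneBandBox} {eSS : Entry} (hSS : B .tppOverT = some eSS)
    {f : (OneBandCoord → ℝ) → ℝ → ℝ} {C : ℝ} (hC0 : 0 ≤ C)
    (hC : ∀ p : OneBandCoord → ℝ, B.Mem p → ∀ s'' : ℝ, |f p s'' - f p 0| ≤ C * |s''|) {L R : ℝ}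
    (hE : HoldsOn (fun p : OneBandCoord → ℝ => L ≤ f p 0 ∧ f p 0 ≤ R) B) :
    HoldsOn (fun p : OneBandCoord → ℝ =>
      L - C * ((max |eSS.encl.fst| |eSS.encl.snd| : ℚ) : ℝ) ≤ f p (p .tppOverT) ∧
        f p (p .tppOverT) ≤ R + C * ((max |eSS.encl.fst| |eSS.encl.snd| : ℚ) : ℝ)) B := by
  intro p hp
  have hm : |p .tppOverT| ≤ ((max |eSS.encl.fst| |eSS.encl.snd| : ℚ) : ℝ) :=
    Entry.abs_le_of_mem (hp _ _ hSS)
  have hCm : C * |p .tppOverT| ≤ C * ((max |eSS.encl.fst| |eSS.encl.snd| : ℚ) : ℝ) :=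
    mul_le_mul_of_nonneg_left hm hC0
  have hL := abs_le.1 ((hC p hp (p .tppOverT)).trans hCm)
  obtain ⟨h1, h2⟩ := hE p hp
  constructor <;> linarith [hL.1, hL.2]

/-! ### Lipschitz in `t''` at fixed filling from a class-wide bound on the third-neighbour bond density -/

/-- **Class-bound Lipschitz constant in `t''` at filling `ρ`.** If every translation-invariant state `σ`
of density `ρ` has `|K₃(σ)| ≤ C` (`K₃(σ) = e_{Φ''(1)}(σ)`, the third-neighbour bond density; `C ≥ 0`),
then `|e_ρ(t,t',t'',U) − e_ρ(t,t',s'',U)| ≤ C|t'' − s''|` — for EVERY `ρ` (an unrealised density is the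
trivial case `0 ≤ C|t'' − s''|`). [cite: Israel1979, Thm. I.3.4] -/
theorem abs_tiGroundEnergyDensityAt_tpp_sub_le_of_classBound (t t' U ρ : ℝ) {C : ℝ} (hC0 : 0 ≤ C)
    (hC : ∀ σ : InfVolFermionState 2, σ.IsTranslationInvariant → σ.density = ρ →
      |σ.meanEnergy (axialRange2HoppingFermionInteraction 2 1) 2| ≤ C) (t'' s'' : ℝ) :
    |(hubbardTT'T''FermionInteraction t t' t'' U).tiGroundEnergyDensityAt 2 ρ -
        (hubbardTT'T''FermionInteraction t t' s'' U).tiGroundEnergyDensityAt 2 ρ| ≤ C * |t'' - s''| := by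
  rcases ({ω : InfVolFermionState 2 | ω.IsTranslationInvariant ∧ ω.density = ρ}).eq_empty_or_nonempty
    with h | h
  · rw [FermionInteraction.tiGroundEnergyDensityAt_eq_infMeanEnergyOn,
      FermionInteraction.tiGroundEnergyDensityAt_eq_infMeanEnergyOn, h,
      FermionInteraction.infMeanEnergyOn_empty, FermionInteraction.infMeanEnergyOn_empty, sub_self, abs_zero]
    positivity
  · exact FermionInteraction.abs_infMeanEnergyOn_pencil_sub_le _ _ 2 h (fun σ hσ => hC σ hσ.1 hσ.2) t'' s''

/-- **`|K₃(σ)| ≤ 4` for every state** (the sharp bond norm `‖E_{Φ''(1)}‖ ≤ 2·2·1` at range parameter `2`).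
[cite: BratteliRobinsonI1987, Prop. 2.3.11] -/
theorem abs_meanEnergy_axialRange2Hopping_one_le_four (σ : InfVolFermionState 2) :
    |σ.meanEnergy (axialRange2HoppingFermionInteraction 2 1) 2| ≤ 4 := by
  refine (σ.abs_meanEnergy_le_norm _ 2).trans ?_
  have h := norm_meanEnergyObs_axialRange2Hopping_le_two_mul (d := 2) (1 : ℝ)
  rw [abs_one, mul_one, Nat.cast_ofNat] at h
  linarith

/-- **Lipschitz in `t''` at fixed filling with the halved constant**, every `ρ`:
`|e_ρ(t,t',t'',U) − e_ρ(t,t',s'',U)| ≤ 4|t'' − s''|`. [cite: Israel1979, Thm. I.3.4] -/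
theorem abs_tiGroundEnergyDensityAt_tpp_sub_le_four_mul (t t' U ρ t'' s'' : ℝ) :
    |(hubbardTT'T''FermionInteraction t t' t'' U).tiGroundEnergyDensityAt 2 ρ -
        (hubbardTT'T''FermionInteraction t t' s'' U).tiGroundEnergyDensityAt 2 ρ| ≤ 4 * |t'' - s''| :=
  abs_tiGroundEnergyDensityAt_tpp_sub_le_of_classBound t t' U ρ (by norm_num)
    (fun σ _ _ => abs_meanEnergy_axialRange2Hopping_one_le_four σ) t'' s''

/-- **Truncation residual at fixed filling, halved constant**: `|e_ρ(t,t',t'',U) − energyDensityTT' t t' U ρ| ≤ 4|t''|`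
(`U ≥ 0`, `0 < ρ < 2`). [cite: Israel1979, Thm. I.3.4] -/
theorem abs_tiGroundEnergyDensityAt_tpp_sub_energyDensityTT'_le_four_mul (t t' : ℝ) {U : ℝ} (hU : 0 ≤ U)
    {ρ : ℝ} (hρ0 : 0 < ρ) (hρ2 : ρ < 2) (t'' : ℝ) :
    |(hubbardTT'T''FermionInteraction t t' t'' U).tiGroundEnergyDensityAt 2 ρ - energyDensityTT' t t' U ρ| ≤
      4 * |t''| := by
  have h := abs_tiGroundEnergyDensityAt_tpp_sub_le_four_mul t t' U ρ t'' 0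
  rwa [tiGroundEnergyDensityAt_hubbardTT'T''_zero t t' hU hρ0 hρ2, sub_zero] at h

/-! ### The seam at fixed filling -/

/-- Members of a box whose `U/t` entry starts at `≥ 0` and whose `n` entry lies inside `(0, 2)` have
`0 ≤ U/t` and `0 < n < 2` (the side conditions of the `t'' = 0` bridge). [folklore] -/
theorem mem_sideConditions {B : OneBandBox} {eU eN : Entry} (hU : B .UOverT = some eU)
    (hN : B .filling = some eN) (hU0 : 0 ≤ eU.encl.fst) (hN0 : 0 < eN.encl.fst) (hN2 : eN.encl.snd < 2)
    {p : OneBandCoord → ℝ} (hp : B.Mem p) : 0 ≤ p .UOverT ∧ 0 < p .filling ∧ p .filling < 2 := by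
  have hu := mem_ratCast_iff.1 (hp _ _ hU)
  have hn := mem_ratCast_iff.1 (hp _ _ hN)
  refine ⟨le_trans (by exact_mod_cast hU0) hu.1, lt_of_lt_of_le (by exact_mod_cast hN0) hn.1,
    lt_of_le_of_lt hn.2 (by exact_mod_cast hN2)⟩

/-- **THE `t''` SEAM AT FIXED FILLING, generic in the class constant.** Let `B` carry entries
`eU, eS, eSS, eN` for `U/t`, `tp/t`, `tpp/t`, `n` with `eU.lo ≥ 0`, `0 < eN.lo`, `eN.hi < 2`; let S2 state
`∀ θ ∈ Set.Icc (s2Lo eU eS eN) (s2Hi eU eS eN), L ≤ energyDensityTT' 1 (θ 1) (θ 0) (θ 2) ≤ R` (the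
`t–t'` energy density at filling `θ 2`, object E, the `_word_Icc` shape); and let `C ≥ 0` bound
`|K₃(σ)|` for every translation-invariant `σ` whose density is a filling of the box. Then on `B` the
fixed-filling density of the `t–t'–t''` object satisfies
`L − C·m ≤ e_{p n}(1, p tp/t, p tpp/t, p U/t) ≤ R + C·m`, `m = max |eSS.lo| |eSS.hi|`. [folklore] -/
theorem holdsOn_tiGroundEnergyDensityAt_objectM_of_classBound {B : OneBandBox} {eU eS eSS eN : Entry}
    (hU : B .UOverT = some eU) (hS : B .tpOverT = some eS) (hSS : B .tppOverT = some eSS)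
    (hN : B .filling = some eN) (hU0 : 0 ≤ eU.encl.fst) (hN0 : 0 < eN.encl.fst) (hN2 : eN.encl.snd < 2)
    {C : ℝ} (hC0 : 0 ≤ C)
    (hC : ∀ ρ : ℝ, eN.Mem ρ → ∀ σ : InfVolFermionState 2, σ.IsTranslationInvariant → σ.density = ρ →
      |σ.meanEnergy (axialRange2HoppingFermionInteraction 2 1) 2| ≤ C)
    {L R : ℝ}
    (hE : ∀ θ ∈ Set.Icc (s2Lo eU eS eN) (s2Hi eU eS eN),
      L ≤ energyDensityTT' 1 (θ 1) (θ 0) (θ 2) ∧ energyDensityTT' 1 (θ 1) (θ 0) (θ 2) ≤ R) :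
    HoldsOn (fun p : OneBandCoord → ℝ =>
      L - C * ((max |eSS.encl.fst| |eSS.encl.snd| : ℚ) : ℝ) ≤
          (hubbardTT'T''FermionInteraction 1 (p .tpOverT) (p .tppOverT) (p .UOverT)).tiGroundEnergyDensityAt
            2 (p .filling) ∧
        (hubbardTT'T''FermionInteraction 1 (p .tpOverT) (p .tppOverT) (p .UOverT)).tiGroundEnergyDensityAt
            2 (p .filling) ≤
          R + C * ((max |eSS.encl.fst| |eSS.encl.snd| : ℚ) : ℝ)) B := by
  refine holdsOn_inflate_of_lipschitzOn hSS
    (f := fun p s'' =>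
      (hubbardTT'T''FermionInteraction 1 (p .tpOverT) s'' (p .UOverT)).tiGroundEnergyDensityAt 2 (p .filling))
    hC0 (fun p hp s'' => ?_) ?_
  · have h := abs_tiGroundEnergyDensityAt_tpp_sub_le_of_classBound 1 (p .tpOverT) (p .UOverT) (p .filling)
      hC0 (hC (p .filling) (hp _ _ hN)) s'' 0
    rwa [sub_zero] at h
  · intro p hp
    obtain ⟨hu0, hn0, hn2⟩ := mem_sideConditions hU hN hU0 hN0 hN2 hp
    have hθ := hE (s2Coords p) (s2Coords_mem_Icc hU hS hN hp)
    have h1 : s2Coords p 1 = p .tpOverT := rfl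
    have h0 : s2Coords p 0 = p .UOverT := rfl
    have h2 : s2Coords p 2 = p .filling := rfl
    rw [h1, h0, h2] at hθ
    change L ≤ (hubbardTT'T''FermionInteraction 1 (p .tpOverT) 0 (p .UOverT)).tiGroundEnergyDensityAt
        2 (p .filling) ∧ (hubbardTT'T''FermionInteraction 1 (p .tpOverT) 0 (p .UOverT)).tiGroundEnergyDensityAt
        2 (p .filling) ≤ R
    rw [tiGroundEnergyDensityAt_hubbardTT'T''_zero 1 (p .tpOverT) hu0 hn0 hn2]
    exact hθ

/-- **«e_n (object M, one-body truncation inflated)» with `C = 4`** — the seam at fixed filling usable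
on every box of record today: the S2 `_word_Icc` window `[L, R]` on the delivered `(U/t, tp/t, n)` box
becomes `[L − 4m, R + 4m]` for the fixed-filling density of the `t–t'–t''` object on the material box,
`m = max |eSS.lo| |eSS.hi|` (La-214 boxes of record: `m = 0.14 ⇒ ±0.56` in units of `t`). [folklore] -/
theorem holdsOn_tiGroundEnergyDensityAt_objectM_four {B : OneBandBox} {eU eS eSS eN : Entry}
    (hU : B .UOverT = some eU) (hS : B .tpOverT = some eS) (hSS : B .tppOverT = some eSS)
    (hN : B .filling = some eN) (hU0 : 0 ≤ eU.encl.fst) (hN0 : 0 < eN.encl.fst) (hN2 : eN.encl.snd < 2)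
    {L R : ℝ}
    (hE : ∀ θ ∈ Set.Icc (s2Lo eU eS eN) (s2Hi eU eS eN),
      L ≤ energyDensityTT' 1 (θ 1) (θ 0) (θ 2) ∧ energyDensityTT' 1 (θ 1) (θ 0) (θ 2) ≤ R) :
    HoldsOn (fun p : OneBandCoord → ℝ =>
      L - 4 * ((max |eSS.encl.fst| |eSS.encl.snd| : ℚ) : ℝ) ≤
          (hubbardTT'T''FermionInteraction 1 (p .tpOverT) (p .tppOverT) (p .UOverT)).tiGroundEnergyDensityAt
            2 (p .filling) ∧
        (hubbardTT'T''FermionInteraction 1 (p .tpOverT) (p .tppOverT) (p .UOverT)).tiGroundEnergyDensityAt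
            2 (p .filling) ≤
          R + 4 * ((max |eSS.encl.fst| |eSS.encl.snd| : ℚ) : ℝ)) B :=
  holdsOn_tiGroundEnergyDensityAt_objectM_of_classBound hU hS hSS hN hU0 hN0 hN2 (by norm_num)
    (fun _ _ σ _ _ => abs_meanEnergy_axialRange2Hopping_one_le_four σ) hE

/-- **Width bookkeeping for the phase-map annex**: the M-window of the generic seam is `2·C·m` wider than
the E-window (`C = 4`: `8m`; kinematic `C = 16/π²`: `(32/π²)·m ≈ 3.24 m`). [folklore] -/
theorem objectM_filling_window_width (L R C : ℝ) (eSS : Entry) :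
    (R + C * ((max |eSS.encl.fst| |eSS.encl.snd| : ℚ) : ℝ)) -
        (L - C * ((max |eSS.encl.fst| |eSS.encl.snd| : ℚ) : ℝ)) =
      (R - L) + 2 * C * ((max |eSS.encl.fst| |eSS.encl.snd| : ℚ) : ℝ) := by
  ring

/-! ### Appendix (2026-08-27, append-only): the kinematic class constant `16/π²`

hubbard-box-p1's `InfVolFermionStateLatticeMapPullback.lean` (p475242: pull-back of states along the
doubling map `x ↦ 2x`, `IsTranslationInvariant.abs_meanEnergy_axialRange2Hopping_le`) bounds the
third-neighbour bond density of EVERY translation-invariant state of filling `ρ ∈ (0, 2)` by the Fermi-sea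
constant `16/π² < 1.6212`. Plugged into `holdsOn_tiGroundEnergyDensityAt_objectM_of_classBound` this is
the object-M energy word of a material box with the allowance `(16/π²)·m` instead of `4·m`
(La-214 boxes of record, `m = 0.14`: `±0.227` instead of `±0.56`, in units of `t`; Hg1201, `m ≈ 0.18`:
`±0.292` instead of `±0.72`). -/

/-- **The kinematic class bound on the box's fillings**: for a box whose `n` entry lies inside `(0, 2)`,
every translation-invariant state whose density is a filling of the box has `|K₃(σ)| ≤ 16/π²`.
[cite: LiebLoss1993, §8, Theorem 8.2] -/
theorem kinematic_classBound_of_entry {eN : Entry} (hN0 : 0 < eN.encl.fst) (hN2 : eN.encl.snd < 2)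
    (ρ : ℝ) (hρ : eN.Mem ρ) (σ : InfVolFermionState 2) (hσ : σ.IsTranslationInvariant)
    (hσρ : σ.density = ρ) :
    |σ.meanEnergy (axialRange2HoppingFermionInteraction 2 1) 2| ≤ 16 / Real.pi ^ 2 := by
  have h := mem_ratCast_iff.1 hρ
  have hρ0 : 0 < ρ := lt_of_lt_of_le (by exact_mod_cast hN0) h.1
  have hρ2 : ρ < 2 := lt_of_le_of_lt h.2 (by exact_mod_cast hN2)
  exact hσ.abs_meanEnergy_axialRange2Hopping_le (by rw [hσρ]; exact hρ0) (by rw [hσρ]; exact hρ2)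

/-- **«e_n (object M, one-body truncation inflated)» with the KINEMATIC constant `16/π²`.** Let `B`
carry entries `eU, eS, eSS, eN` for `U/t`, `tp/t`, `tpp/t`, `n` with `eU.lo ≥ 0`, `0 < eN.lo`,
`eN.hi < 2`, and let S2 state the `_word_Icc` window
`∀ θ ∈ Set.Icc (s2Lo eU eS eN) (s2Hi eU eS eN), L ≤ energyDensityTT' 1 (θ 1) (θ 0) (θ 2) ≤ R`. Then on
`B` the fixed-filling density of the `t–t'–t''` object satisfies
`L − (16/π²)·m ≤ e_{p n}(1, p tp/t, p tpp/t, p U/t) ≤ R + (16/π²)·m`, `m = max |eSS.lo| |eSS.hi|`.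
[cite: LiebLoss1993, §8, Theorem 8.2] -/
theorem holdsOn_tiGroundEnergyDensityAt_objectM_kinematic {B : OneBandBox} {eU eS eSS eN : Entry}
    (hU : B .UOverT = some eU) (hS : B .tpOverT = some eS) (hSS : B .tppOverT = some eSS)
    (hN : B .filling = some eN) (hU0 : 0 ≤ eU.encl.fst) (hN0 : 0 < eN.encl.fst) (hN2 : eN.encl.snd < 2)
    {L R : ℝ}
    (hE : ∀ θ ∈ Set.Icc (s2Lo eU eS eN) (s2Hi eU eS eN),
      L ≤ energyDensityTT' 1 (θ 1) (θ 0) (θ 2) ∧ energyDensityTT' 1 (θ 1) (θ 0) (θ 2) ≤ R) :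
    HoldsOn (fun p : OneBandCoord → ℝ =>
      L - 16 / Real.pi ^ 2 * ((max |eSS.encl.fst| |eSS.encl.snd| : ℚ) : ℝ) ≤
          (hubbardTT'T''FermionInteraction 1 (p .tpOverT) (p .tppOverT) (p .UOverT)).tiGroundEnergyDensityAt
            2 (p .filling) ∧
        (hubbardTT'T''FermionInteraction 1 (p .tpOverT) (p .tppOverT) (p .UOverT)).tiGroundEnergyDensityAt
            2 (p .filling) ≤
          R + 16 / Real.pi ^ 2 * ((max |eSS.encl.fst| |eSS.encl.snd| : ℚ) : ℝ)) B :=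
  holdsOn_tiGroundEnergyDensityAt_objectM_of_classBound hU hS hSS hN hU0 hN0 hN2 (by positivity)
    (fun ρ hρ σ hσ hσρ => kinematic_classBound_of_entry hN0 hN2 ρ hρ σ hσ hσρ) hE

/-- **The kinematic allowance is at most `1.6212·m` per side** (`16/π² < 1.6212`, from `π > 3.141592`):
for the annex bookkeeping in decimal form. [folklore] -/
theorem kinematic_allowance_le (m : ℝ) (hm : 0 ≤ m) : 16 / Real.pi ^ 2 * m ≤ 1.6212 * m := by
  refine mul_le_mul_of_nonneg_right ?_ hm
  have hπ : (3.141592 : ℝ) < Real.pi := Real.pi_gt_d6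
  have hπ2 : (3.141592 : ℝ) ^ 2 < Real.pi ^ 2 := by
    exact pow_lt_pow_left₀ hπ (by norm_num) (by norm_num)
  rw [div_le_iff₀ (by positivity)]
  nlinarith

end Summit.Ventures.CertifiedManyBodySolver.Downfold
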